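import Summits.CriticalPhenomena.PercolationContinuityZ3.Theorems.Transplant.FKConnectivityAllQApexHubRestSP
import Summits.CriticalPhenomena.PercolationContinuityZ3.Theorems.Transplant.FKConnectivityAllQArborealLimit
import HarnessLib

/-!
# Connectivity correlation inequalities — the ARBOREAL GAS at an apex hung on a series–parallel graph: Ayyer–Linusson–Ravichandran's
# Conjecture 7.1 (eq. (15)) at the apex-on-SP triples of `…ApexHubRestSP.lean`

Support file (`--supports stmt-CriticalPhenomena-4575`), census seat `prim-bschramm-census` (gen 23) of the post-continuity programme;
builds on p205010 (kernel theorem, internal audit signed; external expert review pending).  No definitions, no named facts, no sorries;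
standard axioms.  The `q ↓ 0` transfer (fk-1 g9's `hubUnder_agMeasure_of_forall` along the arboreal curve `agParams w q`) of the every-`q > 0`
theorems `hubUnder_apexSP_b/_o/_a`: for the arboreal gas `agMeasure w` (uniform-forest / `q ↓ 0` limit of `φ_{p,q}` with `p/q → w`) whose
activity vector `w` is supported on a completed two-terminal series–parallel support `S` plus the two pairs `ux, xv` of an extra vertex `x`
(an apex over `(u, v)`), ALR's (15) `μ(o ↔ a)μ(b ↔ a) ≤ μ(Ω)μ(o ↔ a ↔ b)` holds at the triples `(x;t;u)` [`ut, vt ∈ S`], `(x;u;t)` [`vu, tu ∈ S`],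
`(u;x;t)` [`uv, tv ∈ S`] — triples with the non-pair `xt` as a hub pair; ALR prove (15) for OUTERPLANAR graphs (their Thm. 5.3 / Cor. 5.4), and
`S ∪ {ux, xv}` here ranges over one-apex extensions of all 2-connected series–parallel graphs (not all outerplanar, not all series–parallel).
[cite: AyyerLinussonRavichandran2025, §7 eq. (15), Conj. 7.1, Thm. 5.3, Cor. 5.4 (p. 22)] [cite: Grimmett2006, §1.5 Thm. (1.23) (pp. 13–14)]
-/

noncomputable section

namespace Summit.CriticalPhenomena.PercolationContinuityZ3.Theorems

namespace FK

open MeasureTheory Set Literature.Probability.LatticeModels Literature.Probability.Percolation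
open scoped Classical

variable {V : Type*} [Fintype V] {E : Finset (Sym2 V)} {s₀ t₀ : V}

/-- **ALR (15) for the arboreal gas at `(x; t; u)`**, `x` an apex over `(u,v)` hung on a completed series–parallel support containing `ut, vt`.
[cite: AyyerLinussonRavichandran2025, §7 eq. (15), Conj. 7.1 (p. 22)] [cite: Grimmett2006, §1.5 Thm. (1.23) (pp. 13–14)] -/
theorem hubUnder_agMeasure_apexSP_b (w : Sym2 V → unitInterval) (hE : IsTTSP E s₀ t₀) {u v x t : V} (hxu : x ≠ u) (hxv : x ≠ v)
    (huv : u ≠ v) (htx : t ≠ x) (hx : ∀ e ∈ insert s(s₀, t₀) E, x ∉ e)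
    (hw : ∀ e, ((w e : unitInterval) : ℝ) ≠ 0 → e ∈ insert s(s₀, t₀) E ∨ e = s(u, x) ∨ e = s(x, v))
    (hut : s(u, t) ∈ insert s(s₀, t₀) E) (hvt : s(v, t) ∈ insert s(s₀, t₀) E) :
    HubUnder (agMeasure w) x t u :=
  hubUnder_agMeasure_of_forall w x t u fun q hq0 _ =>
    hubUnder_apexSP_b (agParams w q) hq0 hE hxu hxv huv htx hx
      (agParams_supp w hq0 (S := {e : Sym2 V | e ∈ insert s(s₀, t₀) E ∨ e = s(u, x) ∨ e = s(x, v)}) hw) hut hvt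

/-- **ALR (15) for the arboreal gas at `(x; u; t)`**, `x` an apex over `(u,v)` hung on a completed series–parallel support containing `vu, tu`.
[cite: AyyerLinussonRavichandran2025, §7 eq. (15), Conj. 7.1 (p. 22)] [cite: Grimmett2006, §1.5 Thm. (1.23) (pp. 13–14)] -/
theorem hubUnder_agMeasure_apexSP_o (w : Sym2 V → unitInterval) (hE : IsTTSP E s₀ t₀) {u v x t : V} (hxu : x ≠ u) (hxv : x ≠ v)
    (huv : u ≠ v) (htx : t ≠ x) (hx : ∀ e ∈ insert s(s₀, t₀) E, x ∉ e)
    (hw : ∀ e, ((w e : unitInterval) : ℝ) ≠ 0 → e ∈ insert s(s₀, t₀) E ∨ e = s(u, x) ∨ e = s(x, v))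
    (hvu : s(v, u) ∈ insert s(s₀, t₀) E) (htu : s(t, u) ∈ insert s(s₀, t₀) E) :
    HubUnder (agMeasure w) x u t :=
  hubUnder_agMeasure_of_forall w x u t fun q hq0 _ =>
    hubUnder_apexSP_o (agParams w q) hq0 hE hxu hxv huv htx hx
      (agParams_supp w hq0 (S := {e : Sym2 V | e ∈ insert s(s₀, t₀) E ∨ e = s(u, x) ∨ e = s(x, v)}) hw) hvu htu

/-- **ALR (15) for the arboreal gas at `(u; x; t)`** (hub at the apex), `x` an apex over `(u,v)` hung on a completed series–parallel support
containing `uv, tv`. [cite: AyyerLinussonRavichandran2025, §7 eq. (15), Conj. 7.1 (p. 22)] [cite: Grimmett2006, §1.5 Thm. (1.23) (pp. 13–14)] -/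
theorem hubUnder_agMeasure_apexSP_a (w : Sym2 V → unitInterval) (hE : IsTTSP E s₀ t₀) {u v x t : V} (hxu : x ≠ u) (hxv : x ≠ v)
    (huv : u ≠ v) (htx : t ≠ x) (hx : ∀ e ∈ insert s(s₀, t₀) E, x ∉ e)
    (hw : ∀ e, ((w e : unitInterval) : ℝ) ≠ 0 → e ∈ insert s(s₀, t₀) E ∨ e = s(u, x) ∨ e = s(x, v))
    (huv' : s(u, v) ∈ insert s(s₀, t₀) E) (htv : s(t, v) ∈ insert s(s₀, t₀) E) :
    HubUnder (agMeasure w) u x t :=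
  hubUnder_agMeasure_of_forall w u x t fun q hq0 _ =>
    hubUnder_apexSP_a (agParams w q) hq0 hE hxu hxv huv htx hx
      (agParams_supp w hq0 (S := {e : Sym2 V | e ∈ insert s(s₀, t₀) E ∨ e = s(u, x) ∨ e = s(x, v)}) hw) huv' htv

end FK

end Summit.CriticalPhenomena.PercolationContinuityZ3.Theorems

end
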